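import Summits.QuantumFields.YangMills.Theorems.PoincareLipschitzHierAlignTower
import Summits.QuantumFields.YangMills.Theorems.PoincareLipschitzHierAlignT3Geometry
import Summits.QuantumFields.YangMills.Theorems.PoincareLipschitzThresholdSums
import HarnessLib

/-!
# Crux stmt-QuantumFields-19936 `HistoryTailL` — THE HIERARCHICAL ALIGNMENT AT THE CRUX'S WINDOWS («ALIGN-T3»):
# under hStab's hierarchical windows around `a`, ONE gauge makes EVERY level-`0` bond within `8·L^{j+1}` of `a` close to `1`,
# j-UNIFORMLY — `dist1 ((U^u) b) ≤ 50L²·Σ_{i≤j} θBal(K−i) + 6644·L²·θBal(K−j)`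

Cell `ym3-torus` (YM ladder rung R3 = continuum SU(2) Yang–Mills on the three-torus — a RUNG, NOT the Clay problem; not d = 4, not
infinite volume, not a mass gap), width seat `ym-ust-19936-w3` gen 12, `--supports stmt-QuantumFields-19936 --as helper`.  LEAD
★w1-19936 g7 word 01:07:50Z «ALIGN GO» (card v1.29 (c); ★w5 g10 LOCATE (R3)-COV §5 route (i): the deep-regime a-priori sup-chart for the K2
supplier plan h⋆ ∕ F5 ∕ F6, missing beyond `j ≈ K∕2`).  THIS FILE reads the tree's hierarchical axial gauge
✓`PoincareLipschitzHierAlignTower.exists_hierAxialGauge_zero` (Bałaban's `(j+1)`-level axial gauge [Balaban1985Averaging] §C (64)–(68) with the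
AVERAGES as coarse variables, top gauge free) at the crux's letters:

* §1 (companion ✓`PoincareLipschitzHierAlignT3Geometry`) the scaled torus geometry of the `T3Family` towers: scaling is an isometry up to `L^i`,
  a level-`0` site is within `3(L^i − 1)` of its block tower, integer representatives near a centre;
* §2 ★★★ `exists_hierGauge_dist1_le_of_windows` — for `j + 3 ≤ K`, `0 < γ ≤ 1`, thresholds `θBal(K−i) ≤ 1∕(75(L+1)²)` at the heights `i ≤ j`
  (the guard of ✓`PoincareLipschitzTowerGuards.loopGuard_le_twelfth`; `γ ≤ γ₁(b₀,p₀)` by ✓`T3Thresholds.exists_gamma_forall_θBal_le`), and a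
  configuration `U` satisfying hStab's hierarchical windows around the level-`(j+1)` plaquette `a` (VERBATIM the hypothesis `hU` of
  ✓`dist1_loopHol_iter_le_of_windows`): there is a gauge `u` of the finest torus such that EVERY level-`0` bond `b` with
  `tdist(b₋, a₋·L^{j+1}) ≤ 8·L^{j+1}` (⊇ the reading set `S₀` of the re-gauged tower F5b-5) satisfies
  `dist1 ((U^u) b) ≤ 50·L²·Σ_{i<j+1} θBal(K−i) + 6644·L²·θBal(K−j)`.
  The tower part is ✓`exists_hierAxialGauge_zero` with `a_i := θBal(K−i)` (its `2d`-local curvature hypotheses discharged from the windows by §1: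
  the plaquettes read sit within `12L^{i+1} + 8L^{j+1} + 61L^i ≤ 64L^{j+1}` of the centre); the TOP gauge is the torus axial gauge
  ✓`T4AxialGaugeSmallField.axialGauge` of `Ū^{j+1}(U)` on the non-wrapping `23`-cube around `a₋` (`j + 3 ≤ K`), whose plaquettes are
  `< 151L²·θBal(K−j)` ONE HEIGHT UP from the height-`j` window (✓`BlockAveragingPlaquetteBoundLocal.dist1_plaqHol_avgFun_lt_of_near`), so every top
  bond costs `≤ 2·22·151L²·θBal(K−j)` (✓`dist1_gaugeAct_axialGauge_le_uniform`).
* §3 ★★ `exists_relGauge_dist1_le_of_windows` — THE TWO-FIELD SUP-CHART: for two configurations `U, U'` with the windows around `a` there is ONE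
  gauge `g` with `dist1 ((U'^g) b · (U b)⁻¹) ≤ 2·(50L²·Σ_{i<j+1} θBal(K−i) + 6644L²·θBal(K−j))` on every such bond (✓`dist1_relGauge_le`); with
  ✓`PoincareLipschitzThresholdSums.sum_θBal_le` the right-hand side is `≤ C(L,b₀,p₀)·γ^{1∕4}`, UNIFORMLY IN `j` AND `K` — the a-priori per-bond chart
  for `W = U'^g·U⁻¹` at every depth.

* §4 ★★★ `exists_gamma_relGauge_dist1_le` — THE UNIFORM FORM: for every `L ≥ 2`, `b₀ > 0`, `p₀ > 0` and EVERY `τ > 0` there is `γ₁ > 0` such that for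
  `γ ≤ γ₁`, EVERY family member, EVERY `K` and EVERY depth `j` with `j + 3 ≤ K`, two hierarchically-small configurations around `a` admit one gauge with
  `dist1 ((U'^g) b · (U b)⁻¹) ≤ τ` on every bond within `8L^{j+1}` of `a₋·L^{j+1}` (thresholds ✓`T3Thresholds.exists_gamma_forall_θBal_le`, sums
  ✓`PoincareLipschitzThresholdSums.exists_gamma_forall_sum_θBal_le`, re-indexing `i ↦ K − i`).

THEOREMS ONLY, def-free; nothing of h⋆, F5∕F6, `BlockLipschitzL`, the stubs of any registered line, the crux `HistoryTailL` or a summit statement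
is proved here.
-/

noncomputable section

open scoped BigOperators

namespace Summit.QuantumFields.YangMills.Theorems.PoincareLipschitzHierAlignT3

open Literature.MathematicalPhysics.QuantumFieldTheory.Balaban1983to89
open Literature.MathematicalPhysics.QuantumFieldTheory.Balaban1983to89.T3ContinuumYM3Torus
open Literature.MathematicalPhysics.QuantumFieldTheory.Balaban1983to89.T3UnitLawDensityEML
open T4Continuum BlockAveraging ExpMeanLog T3UnitScaleTilt
open Literature.MathematicalPhysics.QuantumFieldTheory.Balaban1983to89.B3Taylor310LocalRemainder (tdist_triangle tdist_comm tdist_self)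
open Summit.QuantumFields.YangMills.Theorems.PoincareLipschitzIteratedOfAvgStability (sitesPerDir_zero_eq_mul_pow)
open Summit.QuantumFields.YangMills.Theorems.PoincareLipschitzHierAlignTower (exists_hierAxialGauge_zero dist1_relGauge_le)
open T4AxialGaugeSmallField (castSite castSite_apply boxPlaqs axialGauge dist1_gaugeAct_axialGauge_le_uniform)
open B7Prop1Explicit (e e_apply)

variable {F : T3Family} {K : ℕ}

open Summit.QuantumFields.YangMills.Theorems.PoincareLipschitzHierAlignT3Geometry

/-! ## §2 The hierarchical gauge at hStab's windows -/

section Windows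

variable {j : ℕ} {γ b₀ p₀ : ℝ}

/-- `22 < |T^{(j+1)}|` per direction when `j + 3 ≤ K` (`2·L^{m+K−j−1} ≥ 2·27`): the `23`-cube at the top does not wrap. [folklore] -/
theorem twentytwo_lt_sitesPerDir_succ (hjK : j + 3 ≤ K) : 22 < (F.P K).sitesPerDir (j + 1) := by
  have hL3 : 3 ≤ F.L := (by obtain ⟨k, hk⟩ := F.hL.1; have := F.hL.2; omega)
  have hm := F.hm
  have hN : (F.P K).sitesPerDir (j + 1) = 2 * F.L ^ (F.m + K - (j + 1)) := by unfold Params.sitesPerDir; rfl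
  rw [hN]
  have h27 : 27 ≤ F.L ^ (F.m + K - (j + 1)) :=
    calc 27 = 3 ^ 3 := by norm_num
      _ ≤ F.L ^ 3 := Nat.pow_le_pow_left hL3 3
      _ ≤ F.L ^ (F.m + K - (j + 1)) := Nat.pow_le_pow_right (by omega) (by omega)
  omega

/-- The guard of the averaging at the heights with `θBal ≤ 1∕(75(L+1)²)`: `((5L)²∕4)·θBal < δ_{SU(2)}` (= `1∕3`). [folklore] -/
theorem guard_lt_deltaSU {θ : ℝ} (hθ : θ ≤ 1 / (75 * ((F.L : ℝ) + 1) ^ 2)) :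
    (((((F.P K).d + 2) * (F.P K).L : ℕ) : ℝ) ^ 2 / 4) * θ < deltaSU (Fin 2) := by
  have e5 : ((((F.P K).d + 2) * (F.P K).L : ℕ) : ℝ) = (((5 * F.L : ℕ)) : ℝ) := by
    show ((((3 + 2) * F.L : ℕ)) : ℝ) = (((5 * F.L : ℕ)) : ℝ); norm_num
  rw [e5]
  have h1 := PoincareLipschitzTowerGuards.loopGuard_le_twelfth (F := F) hθ
  have h2 := PoincareLipschitzLevelOneLipschitz.sixth_le_half_deltaSU_two
  linarith

/-- ★★★ **THE HIERARCHICAL GAUGE AT THE CRUX'S WINDOWS (single field).**  Let `j + 3 ≤ K`, `0 < γ ≤ 1`, `0 < b₀`, and let the thresholds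
satisfy `θBal(K−i) ≤ 1∕(75(L+1)²)` at the heights `i ≤ j`.  If `U` satisfies hStab's hierarchical windows around the level-`(j+1)` plaquette
`a` (every plaquette of `Ū^i(U)`, `i ≤ j`, with scaled corner within torus distance `64L^{j+1} − 64L^i` of `a₋·L^{j+1}`, is within `θBal(K−i)` of
`1`), then ONE gauge `u` of the finest torus makes EVERY level-`0` bond `b` within `8·L^{j+1}` of `a₋·L^{j+1}` satisfy
`dist1 ((U^u) b) ≤ 50·L²·Σ_{i<j+1} θBal(K−i) + 6644·L²·θBal(K−j)` — Bałaban's `(j+1)`-level axial gauge with the AVERAGES as coarse variables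
(✓`exists_hierAxialGauge_zero`), topped by the torus axial gauge of `Ū^{j+1}(U)` on the `23`-cube around `a₋` (plaquettes `< 151L²·θBal(K−j)` one
height up from the height-`j` window). [cite: Balaban1985Averaging, (64)-(68) p.29; Balaban1987RG1, (0.3)-(0.4) pp.252-253] -/
theorem exists_hierGauge_dist1_le_of_windows (hjK : j + 3 ≤ K) (hγ : 0 < γ) (hγ1 : γ ≤ 1) (hb : 0 < b₀)
    (hθσ : ∀ i, i ≤ j → θBal F.L γ b₀ p₀ (K - i) ≤ 1 / (75 * ((F.L : ℝ) + 1) ^ 2))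
    (a : Plaq (F.P K) (j + 1)) (U : GaugeField (F.P K) 0 (Matrix.specialUnitaryGroup (Fin 2) ℂ))
    (hU : (∀ (i : ℕ) (q : Plaq (F.P K) i), i < j + 1 → Site.tdist (fun k => ((((q.src k).val * F.L ^ i : ℕ)) : ZMod ((F.P K).sitesPerDir 0))) (fun k => ((((a.src k).val * F.L ^ (j + 1) : ℕ)) : ZMod ((F.P K).sitesPerDir 0))) + 64 * F.L ^ i ≤ 64 * F.L ^ (j + 1) → GaugeGroup.dist1 (GaugeField.plaqHol (Averaging.iter (fun i' => BlockAveraging.blockAvg (P := F.P K) (j := i') T3UnitLawDensityEML.ℰp) i U) q) < T3UnitScaleTilt.θBal F.L γ b₀ p₀ (K - i))) :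
    ∃ u : GaugeTransf (F.P K) 0 (Matrix.specialUnitaryGroup (Fin 2) ℂ), ∀ b : PBond (F.P K) 0,
      Site.tdist b.src (fun k => ((((a.src k).val * F.L ^ (j + 1) : ℕ)) : ZMod ((F.P K).sitesPerDir 0))) ≤ 8 * F.L ^ (j + 1) →
      dist1 (GaugeField.gaugeAct u U b) ≤
        50 * (F.L : ℝ) ^ 2 * (∑ i ∈ Finset.range (j + 1), θBal F.L γ b₀ p₀ (K - i)) + 6644 * (F.L : ℝ) ^ 2 * θBal F.L γ b₀ p₀ (K - j) := by
  have hL3 : 3 ≤ F.L := (by obtain ⟨k, hk⟩ := F.hL.1; have := F.hL.2; omega)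
  have hm := F.hm
  have hd : (F.P K).d = 3 := rfl
  have hj1 : j + 1 ≤ (F.P K).m + (F.P K).K := by show j + 1 ≤ F.m + K; omega
  have hθ0 : ∀ i, 0 ≤ θBal F.L γ b₀ p₀ (K - i) := fun i =>
    (T3MinimiserStabilityReduction.θBal_pos (by omega) hγ hγ1 hb p₀ (K - i)).le
  set A₀ : Site (F.P K) 0 := fun k => ((((a.src k).val * F.L ^ (j + 1) : ℕ)) : ZMod ((F.P K).sitesPerDir 0)) with hA₀
  set θj := θBal F.L γ b₀ p₀ (K - j) with hθj
  -- powers of `L`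
  have hLj : 0 < F.L ^ j := pow_pos (by omega) j
  have eLj1 : F.L ^ (j + 1) = F.L * F.L ^ j := by rw [pow_succ]; ring
  /- STEP 1: the TOP gauge — the torus axial gauge of `Ū^{j+1}(U)` on the `23`-cube around `a₋` -/
  set V : GaugeField (F.P K) (j + 1) (Matrix.specialUnitaryGroup (Fin 2) ℂ) :=
    Averaging.iter (fun i' => BlockAveraging.blockAvg (P := F.P K) (j := i') T3UnitLawDensityEML.ℰp) (j + 1) U with hV
  have hVavg : V = avgFun (expMeanLogSU (n := Fin 2))
      (Averaging.iter (fun i' => BlockAveraging.blockAvg (P := F.P K) (j := i') T3UnitLawDensityEML.ℰp) j U) := rfl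
  -- integer representative of the centre and the cube `[A − 11, A + 11]`
  let A : Fin (F.P K).d → ℤ := fun k => ((a.src k).val : ℤ)
  have hA : a.src = (castSite A : Site (F.P K) (j + 1)) := by
    funext k; rw [castSite_apply]; show a.src k = (((((a.src k).val : ℕ) : ℤ)) : ZMod _); rw [Int.cast_natCast, ZMod.natCast_zmod_val]
  let lo : Fin (F.P K).d → ℤ := fun k => A k - 11
  let hi : Fin (F.P K).d → ℤ := fun k => A k + 11
  have hn : ∀ κ, hi κ ≤ lo κ + (22 : ℕ) := fun κ => by show A κ + 11 ≤ A κ - 11 + ((22 : ℕ) : ℤ); push_cast; omega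
  have hnN : 22 < (F.P K).sitesPerDir (j + 1) := twentytwo_lt_sitesPerDir_succ (F := F) hjK
  -- the top plaquettes: one height up from the height-`j` window
  have htop : PlaqSmallOn (boxPlaqs lo hi) (((F.L : ℝ) ^ 2 + 6 * (((5 * F.L : ℕ)) : ℝ) ^ 2) * θj) V := by
    intro p hp
    obtain ⟨z, hzlo, hzhi, hsrc⟩ := hp
    -- `p₋` is within torus distance `33` of `a₋`
    have hpz : Site.tdist p.src a.src ≤ 33 := by
      have ez : z = A + (z - A) := by abel
      rw [hsrc, hA, ez]
      refine (tdist_castSite_add_le A (z - A)).trans ?_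
      calc ∑ k, ((z - A) k).natAbs ≤ ∑ _k : Fin (F.P K).d, 11 := Finset.sum_le_sum fun k _ => by
              have h1 : A k - 11 ≤ z k := hzlo k
              have h2 : z k + e p.μ k + e p.ν k ≤ A k + 11 := hzhi k
              rw [e_apply, e_apply] at h2
              show (z k - A k).natAbs ≤ 11
              split_ifs at h2 <;> omega
        _ = 33 := by rw [Finset.sum_const, Finset.card_univ, Fintype.card_fin, hd, smul_eq_mul]
    have e5 : ((((F.P K).d + 2) * (F.P K).L : ℕ) : ℝ) = (((5 * F.L : ℕ)) : ℝ) := by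
      show ((((3 + 2) * F.L : ℕ)) : ℝ) = (((5 * F.L : ℕ)) : ℝ); norm_num
    have key := BlockAveragingPlaquetteBoundLocal.dist1_plaqHol_avgFun_lt_of_near (n := Fin 2) hj1 (hθ0 j)
      (U := Averaging.iter (fun i' => BlockAveraging.blockAvg (P := F.P K) (j := i') T3UnitLawDensityEML.ℰp) j U) p
      (fun q hq => hU j q (by omega) (by
        -- `q`'s block is within `ℓ^∞`-distance `1` of `p₋`, hence within torus distance `36` of `a₋` at level `j+1`
        have h1 : Site.tdist (blockOf q.src) a.src ≤ 36 :=
          (tdist_triangle _ p.src _).trans (by have := tdist_le_three_of_near (blockOf q.src) p.src hq; omega)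
        have h2 : Site.tdist (fun k => ((((q.src k).val * F.L ^ j : ℕ)) : ZMod ((F.P K).sitesPerDir 0)))
            (fun k => ((((blockOf q.src k).val * F.L ^ (j + 1) : ℕ)) : ZMod ((F.P K).sitesPerDir 0))) ≤ 3 * F.L ^ (j + 1) := by
          refine (tdist_scaled_blockOf_le (F := F) (K := K) hj1 q.src).trans ?_
          rw [pow_succ, mul_comm (F.L ^ j)]
          exact Nat.mul_le_mul_left _ (Nat.mul_le_mul_right _ (Nat.sub_le _ _))
        have h3 : Site.tdist (fun k => ((((blockOf q.src k).val * F.L ^ (j + 1) : ℕ)) : ZMod ((F.P K).sitesPerDir 0))) A₀ ≤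
            36 * F.L ^ (j + 1) := by
          rw [hA₀, tdist_scaled_eq (F := F) (K := K) hj1 (blockOf q.src) a.src, mul_comm]
          exact Nat.mul_le_mul_right _ h1
        have h4 := tdist_triangle (fun k => ((((q.src k).val * F.L ^ j : ℕ)) : ZMod ((F.P K).sitesPerDir 0)))
          (fun k => ((((blockOf q.src k).val * F.L ^ (j + 1) : ℕ)) : ZMod ((F.P K).sitesPerDir 0))) A₀
        have hp2 : 3 * F.L ^ j ≤ F.L ^ (j + 1) := by rw [pow_succ, mul_comm]; exact Nat.mul_le_mul_left _ hL3
        rw [hA₀] at h3 h4 ⊢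
        omega))
      (guard_lt_deltaSU (hθσ j le_rfl))
    rw [← hVavg] at key
    have e5' : ((((F.P K).d + 2) * (F.P K).L : ℕ) : ℝ) = (((5 * F.L : ℕ)) : ℝ) := e5
    have eL : ((F.P K).L : ℝ) = F.L := rfl
    rw [e5', eL] at key
    exact key
  have hδtop : 0 ≤ ((F.L : ℝ) ^ 2 + 6 * (((5 * F.L : ℕ)) : ℝ) ^ 2) * θj := by have := hθ0 j; positivity
  set hTop := axialGauge V lo hi with hhTop
  /- STEP 2: the tower below the top gauge -/
  obtain ⟨u, hu⟩ := exists_hierAxialGauge_zero (n := Fin 2) (P := F.P K) (j + 1) hj1 U hTop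
  refine ⟨u, fun b hb => ?_⟩
  -- the block tower of `b₋`
  let y : (i : ℕ) → Site (F.P K) i := fun i => Nat.rec (motive := fun i => Site (F.P K) i) b.src (fun _ z => blockOf z) i
  have hy0 : y 0 = b.src := rfl
  have hysucc : ∀ i, y (i + 1) = blockOf (y i) := fun i => rfl
  have hguard : ∀ i, i < j + 1 → (((((F.P K).d + 2) * (F.P K).L : ℕ) : ℝ) ^ 2 / 4) * θBal F.L γ b₀ p₀ (K - i) < deltaSU (Fin 2) :=
    fun i hi => guard_lt_deltaSU (hθσ i (by omega))
  -- the `2d`-local curvature hypotheses of the tower, from the windows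
  have hloc : ∀ (i : ℕ) (hi : i < j + 1) (q : Plaq (F.P K) i), Site.tdist (blockOf q.src) (y (i + 1)) ≤ 2 * (F.P K).d →
      dist1 (GaugeField.plaqHol
        (Averaging.iter (fun i' => BlockAveraging.blockAvg (P := F.P K) (j := i') (expMeanLogSU (n := Fin 2))) i U) q) <
        θBal F.L γ b₀ p₀ (K - i) := by
    intro i hi q hq
    rw [hd] at hq
    refine hU i q hi ?_
    have hi1 : i + 1 ≤ F.m + K := by omega
    have h1 : Site.tdist (fun k => ((((q.src k).val * F.L ^ i : ℕ)) : ZMod ((F.P K).sitesPerDir 0)))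
        (fun k => ((((blockOf q.src k).val * F.L ^ (i + 1) : ℕ)) : ZMod ((F.P K).sitesPerDir 0))) ≤ 3 * F.L ^ (i + 1) := by
      refine (tdist_scaled_blockOf_le (F := F) (K := K) hi1 q.src).trans ?_
      rw [pow_succ, mul_comm (F.L ^ i)]
      exact Nat.mul_le_mul_left _ (Nat.mul_le_mul_right _ (Nat.sub_le _ _))
    have h2 : Site.tdist (fun k => ((((blockOf q.src k).val * F.L ^ (i + 1) : ℕ)) : ZMod ((F.P K).sitesPerDir 0)))
        (fun k => ((((y (i + 1) k).val * F.L ^ (i + 1) : ℕ)) : ZMod ((F.P K).sitesPerDir 0))) ≤ 6 * F.L ^ (i + 1) := by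
      rw [tdist_scaled_eq (F := F) (K := K) hi1 (blockOf q.src) (y (i + 1)), mul_comm]
      exact Nat.mul_le_mul_right _ hq
    have h3 := tdist_blockTower_le (F := F) (K := K) y hysucc (i + 1) hi1
    rw [hy0] at h3
    have h4 := tdist_triangle (fun k => ((((q.src k).val * F.L ^ i : ℕ)) : ZMod ((F.P K).sitesPerDir 0)))
      (fun k => ((((blockOf q.src k).val * F.L ^ (i + 1) : ℕ)) : ZMod ((F.P K).sitesPerDir 0))) A₀
    have h5 := tdist_triangle (fun k => ((((blockOf q.src k).val * F.L ^ (i + 1) : ℕ)) : ZMod ((F.P K).sitesPerDir 0)))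
      (fun k => ((((y (i + 1) k).val * F.L ^ (i + 1) : ℕ)) : ZMod ((F.P K).sitesPerDir 0))) A₀
    have h6 := tdist_triangle (fun k => ((((y (i + 1) k).val * F.L ^ (i + 1) : ℕ)) : ZMod ((F.P K).sitesPerDir 0))) b.src A₀
    rw [tdist_comm _ b.src] at h6
    rw [hA₀] at h4 h5 h6 hb ⊢
    -- powers: `3·L^i ≤ L^{i+1} ≤ L^{j+1}`
    have hp1 : F.L ^ (i + 1) ≤ F.L ^ (j + 1) := Nat.pow_le_pow_right (by omega) (by omega)
    have hp2 : 3 * F.L ^ i ≤ F.L ^ (i + 1) := by rw [pow_succ, mul_comm]; exact Nat.mul_le_mul_left _ hL3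
    omega
  have hmain := hu b y hy0 hysucc (fun i => θBal F.L γ b₀ p₀ (K - i)) hθ0 hguard hloc
  /- STEP 3: the top bond `⟨y_{j+1}, dir b⟩` lies in the cube -/
  have hytop : Site.tdist (y (j + 1)) a.src ≤ 10 := by
    have h2 := tdist_scaled_eq (F := F) (K := K) hj1 (y (j + 1)) a.src
    have h3 := tdist_blockTower_le (F := F) (K := K) y hysucc (j + 1) hj1
    rw [hy0] at h3
    have h6 := tdist_triangle (fun k => ((((y (j + 1) k).val * F.L ^ (j + 1) : ℕ)) : ZMod ((F.P K).sitesPerDir 0))) b.src A₀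
    rw [tdist_comm _ b.src] at h6
    rw [hA₀] at h6 hb
    have hlt : F.L ^ (j + 1) * Site.tdist (y (j + 1)) a.src < F.L ^ (j + 1) * 11 := by
      have hLj1 : 1 ≤ F.L ^ (j + 1) := Nat.one_le_pow _ _ (by omega)
      rw [← h2]; omega
    have := Nat.lt_of_mul_lt_mul_left hlt
    omega
  obtain ⟨x, hxy, hxA⟩ := exists_int_rep_of_tdist_le (y (j + 1)) a.src A hA hytop
  have hxlo : lo ≤ x := fun k => by show A k - 11 ≤ x k; have := (hxA k).1; push_cast at this; omega
  have hxhi : x + e b.dir ≤ hi := fun k => by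
    show x k + e b.dir k ≤ A k + 11
    have := (hxA k).2; push_cast at this
    rw [e_apply]; split_ifs <;> omega
  have htopbond := dist1_gaugeAct_axialGauge_le_uniform V (subset_refl _) htop hδtop hn hnN hxlo hxhi
  rw [hxy] at htopbond
  have hbd : ((((F.P K).d - 1 : ℕ)) : ℝ) = 2 := by rw [hd]; norm_num
  rw [hbd] at htopbond
  /- assembly -/
  have e5 : ((((F.P K).d + 2) * (F.P K).L : ℕ) : ℝ) = 5 * (F.L : ℝ) := by
    show ((((3 + 2) * F.L : ℕ)) : ℝ) = 5 * (F.L : ℝ); push_cast; ring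
  rw [e5] at hmain
  have e50 : 2 * ((5 * (F.L : ℝ)) ^ 2) = 50 * (F.L : ℝ) ^ 2 := by ring
  rw [e50] at hmain
  have etop : 2 * (22 : ℕ) * (((F.L : ℝ) ^ 2 + 6 * (((5 * F.L : ℕ)) : ℝ) ^ 2) * θj) = 6644 * (F.L : ℝ) ^ 2 * θj := by
    push_cast; ring
  rw [etop] at htopbond
  have eb : (⟨y (j + 1), b.dir⟩ : PBond (F.P K) (j + 1)) = ⟨y (j + 1), b.dir⟩ := rfl
  linarith [hmain, htopbond]

/-- ★★ **THE TWO-FIELD SUP-CHART AT THE CRUX'S WINDOWS.**  Under the hypotheses of `exists_hierGauge_dist1_le_of_windows` for TWO configurations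
`U, U'` (both hierarchically small around `a`), there is ONE gauge `g` of the finest torus with
`dist1 ((U'^g) b · (U b)⁻¹) ≤ 2·(50L²·Σ_{i<j+1} θBal(K−i) + 6644L²·θBal(K−j))` on every level-`0` bond within `8·L^{j+1}` of `a₋·L^{j+1}` — the
a-priori per-bond chart for `W = U'^g U⁻¹` in the deep regime of the K2 supplier plan, j-UNIFORM once the thresholds are summable
(✓`PoincareLipschitzThresholdSums.sum_θBal_le`). [cite: Balaban1985Averaging, (64)-(68) p.29] -/
theorem exists_relGauge_dist1_le_of_windows (hjK : j + 3 ≤ K) (hγ : 0 < γ) (hγ1 : γ ≤ 1) (hb : 0 < b₀)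
    (hθσ : ∀ i, i ≤ j → θBal F.L γ b₀ p₀ (K - i) ≤ 1 / (75 * ((F.L : ℝ) + 1) ^ 2))
    (a : Plaq (F.P K) (j + 1)) (U U' : GaugeField (F.P K) 0 (Matrix.specialUnitaryGroup (Fin 2) ℂ))
    (hU : (∀ (i : ℕ) (q : Plaq (F.P K) i), i < j + 1 → Site.tdist (fun k => ((((q.src k).val * F.L ^ i : ℕ)) : ZMod ((F.P K).sitesPerDir 0))) (fun k => ((((a.src k).val * F.L ^ (j + 1) : ℕ)) : ZMod ((F.P K).sitesPerDir 0))) + 64 * F.L ^ i ≤ 64 * F.L ^ (j + 1) → GaugeGroup.dist1 (GaugeField.plaqHol (Averaging.iter (fun i' => BlockAveraging.blockAvg (P := F.P K) (j := i') T3UnitLawDensityEML.ℰp) i U) q) < T3UnitScaleTilt.θBal F.L γ b₀ p₀ (K - i)))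
    (hU' : (∀ (i : ℕ) (q : Plaq (F.P K) i), i < j + 1 → Site.tdist (fun k => ((((q.src k).val * F.L ^ i : ℕ)) : ZMod ((F.P K).sitesPerDir 0))) (fun k => ((((a.src k).val * F.L ^ (j + 1) : ℕ)) : ZMod ((F.P K).sitesPerDir 0))) + 64 * F.L ^ i ≤ 64 * F.L ^ (j + 1) → GaugeGroup.dist1 (GaugeField.plaqHol (Averaging.iter (fun i' => BlockAveraging.blockAvg (P := F.P K) (j := i') T3UnitLawDensityEML.ℰp) i U') q) < T3UnitScaleTilt.θBal F.L γ b₀ p₀ (K - i))) :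
    ∃ g : GaugeTransf (F.P K) 0 (Matrix.specialUnitaryGroup (Fin 2) ℂ), ∀ b : PBond (F.P K) 0,
      Site.tdist b.src (fun k => ((((a.src k).val * F.L ^ (j + 1) : ℕ)) : ZMod ((F.P K).sitesPerDir 0))) ≤ 8 * F.L ^ (j + 1) →
      dist1 (GaugeField.gaugeAct g U' b * (U b)⁻¹) ≤
        2 * (50 * (F.L : ℝ) ^ 2 * (∑ i ∈ Finset.range (j + 1), θBal F.L γ b₀ p₀ (K - i)) + 6644 * (F.L : ℝ) ^ 2 * θBal F.L γ b₀ p₀ (K - j)) := by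
  obtain ⟨u, hu⟩ := exists_hierGauge_dist1_le_of_windows hjK hγ hγ1 hb hθσ a U hU
  obtain ⟨u', hu'⟩ := exists_hierGauge_dist1_le_of_windows hjK hγ hγ1 hb hθσ a U' hU'
  refine ⟨fun x => (u x)⁻¹ * u' x, fun b hb => ?_⟩
  have h := dist1_relGauge_le U U' u u' b (hu b hb) (hu' b hb)
  linarith

end Windows


/-! ## §4 The uniform form: a sup-chart `τ` at every depth once `γ ≤ γ₁(L, b₀, p₀, τ)` -/

section Uniform

/-- Re-indexing the heights: `Σ_{i<j+1} θBal(K−i) = Σ_{n ∈ {K−j,…,K}} θBal n` (`j + 1 ≤ K`). [folklore] -/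
theorem sum_range_θBal_eq_sum_image {L : ℕ} {γ b₀ p₀ : ℝ} {K j : ℕ} (hjK : j + 1 ≤ K) :
    ∑ i ∈ Finset.range (j + 1), θBal L γ b₀ p₀ (K - i) =
      ∑ n ∈ (Finset.range (j + 1)).image (fun i => K - i), θBal L γ b₀ p₀ n := by
  rw [Finset.sum_image]
  intro x hx y hy hxy
  simp only [Finset.coe_range, Set.mem_Iio] at hx hy
  have hxy' : K - x = K - y := hxy
  omega

/-- ★★★ **THE TWO-FIELD SUP-CHART, UNIFORM IN THE DEPTH AND THE CUT-OFF.**  For every block size `L ≥ 2`, profile `b₀ > 0`, `p₀ > 0` and every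
`τ > 0` there is `γ₁ ∈ (0, 1]` such that: for every member `F` of a `T3Family` with `F.L = L`, every `0 < γ ≤ γ₁`, every `K` and `j` with `j + 3 ≤ K`,
every level-`(j+1)` plaquette `a` and every two configurations `U, U'` satisfying hStab's hierarchical windows around `a`, ONE gauge `g` of the finest
torus gives `dist1 ((U'^g) b · (U b)⁻¹) ≤ τ` on every level-`0` bond within `8·L^{j+1}` of `a₋·L^{j+1}` — the a-priori per-bond chart of the K2
deep regime (Bałaban's hierarchical axial gauge, [Balaban1985Averaging] §C (64)–(68), read at the crux's thresholds [Balaban1985UV3] (7) p.257).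
[cite: Balaban1985Averaging, (64)-(68) p.29; Balaban1985UV3, (7) p.257] -/
theorem exists_gamma_relGauge_dist1_le (L : ℕ) (hL : 2 ≤ L) {b₀ p₀ : ℝ} (hb : 0 < b₀) (hp : 0 < p₀) {τ : ℝ} (hτ : 0 < τ) :
    ∃ γ₁ : ℝ, 0 < γ₁ ∧ γ₁ ≤ 1 ∧ ∀ (F : T3Family) (γ : ℝ), F.L = L → 0 < γ → γ ≤ γ₁ →
      ∀ (K j : ℕ), j + 3 ≤ K → ∀ (a : Plaq (F.P K) (j + 1)) (U U' : GaugeField (F.P K) 0 (Matrix.specialUnitaryGroup (Fin 2) ℂ)),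
        (∀ (i : ℕ) (q : Plaq (F.P K) i), i < j + 1 → Site.tdist (fun k => ((((q.src k).val * F.L ^ i : ℕ)) : ZMod ((F.P K).sitesPerDir 0))) (fun k => ((((a.src k).val * F.L ^ (j + 1) : ℕ)) : ZMod ((F.P K).sitesPerDir 0))) + 64 * F.L ^ i ≤ 64 * F.L ^ (j + 1) → GaugeGroup.dist1 (GaugeField.plaqHol (Averaging.iter (fun i' => BlockAveraging.blockAvg (P := F.P K) (j := i') T3UnitLawDensityEML.ℰp) i U) q) < T3UnitScaleTilt.θBal F.L γ b₀ p₀ (K - i)) →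
        (∀ (i : ℕ) (q : Plaq (F.P K) i), i < j + 1 → Site.tdist (fun k => ((((q.src k).val * F.L ^ i : ℕ)) : ZMod ((F.P K).sitesPerDir 0))) (fun k => ((((a.src k).val * F.L ^ (j + 1) : ℕ)) : ZMod ((F.P K).sitesPerDir 0))) + 64 * F.L ^ i ≤ 64 * F.L ^ (j + 1) → GaugeGroup.dist1 (GaugeField.plaqHol (Averaging.iter (fun i' => BlockAveraging.blockAvg (P := F.P K) (j := i') T3UnitLawDensityEML.ℰp) i U') q) < T3UnitScaleTilt.θBal F.L γ b₀ p₀ (K - i)) →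
        ∃ g : GaugeTransf (F.P K) 0 (Matrix.specialUnitaryGroup (Fin 2) ℂ), ∀ b : PBond (F.P K) 0,
          Site.tdist b.src (fun k => ((((a.src k).val * F.L ^ (j + 1) : ℕ)) : ZMod ((F.P K).sitesPerDir 0))) ≤ 8 * F.L ^ (j + 1) →
          dist1 (GaugeField.gaugeAct g U' b * (U b)⁻¹) ≤ τ := by
  -- thresholds: the guard at every height, and summable sums of size `σ`
  obtain ⟨γa, hγa, hγa1, hθa⟩ := T3Thresholds.exists_gamma_forall_θBal_le (b₀ := b₀) (p₀ := p₀) hb hp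
    (σ := 1 / (75 * ((L : ℝ) + 1) ^ 2)) (by positivity)
  set σ : ℝ := τ / (2 * (50 + 6644) * (L : ℝ) ^ 2) with hσ
  have hL0 : (0 : ℝ) < L := by exact_mod_cast (show 0 < L by omega)
  have hσ0 : 0 < σ := by rw [hσ]; positivity
  obtain ⟨γs, hγs, hγs1, hθs⟩ := PoincareLipschitzThresholdSums.exists_gamma_forall_sum_θBal_le (b₀ := b₀) (p₀ := p₀) hb hp hσ0
  refine ⟨min γa γs, lt_min hγa hγs, (min_le_left _ _).trans hγa1, ?_⟩
  intro F γ hFL hγ hγ1 K j hjK a U U' hU hU'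
  subst hFL
  have hγa' : γ ≤ γa := hγ1.trans (min_le_left _ _)
  have hγs' : γ ≤ γs := hγ1.trans (min_le_right _ _)
  have hγone : γ ≤ 1 := hγa'.trans hγa1
  have hθσ : ∀ i, i ≤ j → θBal F.L γ b₀ p₀ (K - i) ≤ 1 / (75 * ((F.L : ℝ) + 1) ^ 2) :=
    fun i _ => hθa F.L (by omega) γ hγ hγa' (K - i)
  obtain ⟨g, hg⟩ := exists_relGauge_dist1_le_of_windows hjK hγ hγone hb hθσ a U U' hU hU'
  refine ⟨g, fun b hb8 => (hg b hb8).trans ?_⟩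
  -- the sums are `≤ σ`
  have hsum : ∑ i ∈ Finset.range (j + 1), θBal F.L γ b₀ p₀ (K - i) ≤ σ := by
    rw [sum_range_θBal_eq_sum_image (by omega)]
    exact hθs F.L hL γ hγ hγs' _
  have htop : θBal F.L γ b₀ p₀ (K - j) ≤ σ := by
    have h := hθs F.L hL γ hγ hγs' {K - j}
    rwa [Finset.sum_singleton] at h
  have hL2 : (0 : ℝ) ≤ (F.L : ℝ) ^ 2 := by positivity
  calc 2 * (50 * (F.L : ℝ) ^ 2 * (∑ i ∈ Finset.range (j + 1), θBal F.L γ b₀ p₀ (K - i)) + 6644 * (F.L : ℝ) ^ 2 * θBal F.L γ b₀ p₀ (K - j))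
      ≤ 2 * (50 * (F.L : ℝ) ^ 2 * σ + 6644 * (F.L : ℝ) ^ 2 * σ) := by
        have h1 := mul_le_mul_of_nonneg_left hsum (by positivity : (0 : ℝ) ≤ 50 * (F.L : ℝ) ^ 2)
        have h2 := mul_le_mul_of_nonneg_left htop (by positivity : (0 : ℝ) ≤ 6644 * (F.L : ℝ) ^ 2)
        linarith
    _ = τ := by rw [hσ]; field_simp

end Uniform

end Summit.QuantumFields.YangMills.Theorems.PoincareLipschitzHierAlignT3

end
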